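import Summits.CriticalPhenomena.PercolationContinuityZ3.Theorems.PercNearOneGluingNoHeavyRsw3InvasionOneEnded
import Literature.Probability.Percolation.TwoGhostSpace
import HarnessLib

/-!
# RSW3 lane (P2, gen 29): INVASION PERCOLATION XXXI — THE PONDS ARE THE LEVEL SETS OF THE LOCAL PERCOLATION THRESHOLD ALONG THE INVASION:
# every vertex of the pond closed by the outlet `ê_k` percolates at level `τ̂_k` and at no lower level; a.s. on `ℤ^d` (`d ≥ 2`, p205010) every invaded
# vertex has local threshold equal to an outlet label `τ̂_k > p_c(ℤ^d)`, and these thresholds decrease strictly to `p_c`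

builds on p205010 (kernel theorem, internal audit signed; external expert review pending) — USED only in §4 (the `ℤ^d` statements, through file XXX).

Cell `prim-rsw3`, prover seat `prim-rsw3-p2` (gen 29), memo `run/shared/lean/prim/rsw3/P2-RSWLITE.md` §36.  Support file
(`--supports stmt-CriticalPhenomena-4575`); no definitions, no named facts, no sorries.  Notation: `I_n = invasion G U o n`, `x_n = acceptedLabel G U o n`,
`C_y(v) = openCluster (configOfLabels y U G) v` (the cluster of `v` using bonds of label `≤ y`), outlet `IsOutlet G U o m :⟺ ∀ n > m, x_n < x_m`; two outlet steps
`m < m'` are CONSECUTIVE when no step strictly between them is an outlet; the vertices invaded at times in `(m, m']` form the POND closed by `ê_{m'}`.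

In the monotone coupling the LOCAL PERCOLATION THRESHOLD of a vertex `v` is `inf {y : |C_y(v)| = ∞}`.  The pond–outlet chain of files XXVIII–XXX
computes it along the invasion, on every infinite connected locally finite graph and for every label field:

* §1 `forall_acceptedLabel_le_of_firstOutlet` (an outlet preceded by no outlet carries the maximum of ALL labels), **`acceptedLabel_le_of_consecutive`**
  (between consecutive outlets `m < m'`, and indeed at every time after `m`, the accepted labels are `≤ x_{m'}`) — by the record lemma of file XXVIII.
* §2 **`openCluster_subset_invasion_of_isOutlet`** — for `v ∈ I_m` (`m` an outlet) and `y < x_m`: `C_y(v) ⊆ I_m`, finite (the pond closure is a union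
  of complete `y`-clusters, file IX); **`mem_openCluster_snd_of_isOutlet`** — if all labels accepted after the outlet `m` are `≤ y`, every vertex invaded
  after `m` lies in `C_y(a.2)`, `a` the outlet dart, which is then infinite (`infinite_openCluster_of_invaded_after_outlet`).
* §3 THE THRESHOLD THEOREMS (deterministic): **`openCluster_finite_iff_of_consecutive`** — for consecutive outlets `m < m'` and `v ∈ I_{m'} ∖ I_m`:
  `C_y(v)` is finite iff `y < x_{m'}` (so `v` percolates exactly from level `τ̂ = x_{m'}` on, threshold ATTAINED); **`openCluster_finite_iff_of_firstOutlet`**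
  — for the first outlet `m₁` and `v ∈ I_{m₁}`: `C_y(v)` finite iff `y < x_{m₁}`.
* §4 `ℤ^d`, `d ≥ 2` (p205010): **`ae_forall_invaded_threshold_eq_outletLabel`** — a.s. EVERY invaded vertex `v` admits an outlet step `m` with `v ∈ I_m` and
  (`C_y(v)` finite ⟺ `y < x_m`): its local threshold is the outlet label `x_m > p_c(ℤ^d)`; with file XXX the thresholds met along the invasion are
  `τ̂_1 > τ̂_2 > ⋯ ↓ p_c`: **the invasion threads vertices of ever lower — but always supercritical — local threshold** (`ae_exists_invaded_threshold_lt`).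

References: M. Damron, A. Sapozhnikov, B. Vágvölgyi, Ann. Probab. 37 (2009) 2297–2331, §1.1 (ponds `V̂_k`, outlets `ê_k`, `τ̂_k`); R. Lyons, Y. Peres, O. Schramm,
Ann. Probab. 34 (2006), Thm. 3.12 (proof) [LyonsPeresSchramm2006]; J. T. Chayes, L. Chayes, C. M. Newman, Comm. Math. Phys. 101 (1985) §3 (ii) [ChayesChayesNewman1985].
-/

noncomputable section

namespace Summit.CriticalPhenomena.PercolationContinuityZ3.Theorems.Rsw3

open Finset Filter MeasureTheory Literature.Probability.LatticeModels Literature.Probability.Percolation Literature.Probability.Percolation.Invasion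

section General

variable {V : Type*} [DecidableEq V] {G : SimpleGraph V} [G.LocallyFinite]

/-! ## §1 Labels between consecutive outlets -/

/-- **An outlet preceded by no outlet carries the largest label of all** (`τ̂_1 = max_n x_n`): if some earlier label were larger, the last maximiser of the
labels on `[0, m₁]` would be an earlier outlet. [cite: LyonsPeresSchramm2006, Thm. 3.12 (proof)] -/
theorem forall_acceptedLabel_le_of_firstOutlet {U : Sym2 V → ℝ} {o : V} {m₁ : ℕ} (hm₁ : IsOutlet G U o m₁)
    (hfirst : ∀ j, j < m₁ → ¬ IsOutlet G U o j) (n : ℕ) : acceptedLabel G U o n ≤ acceptedLabel G U o m₁ := by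
  by_contra hlt
  push Not at hlt
  have hev : ∀ᶠ j in atTop, acceptedLabel G U o j ≤ acceptedLabel G U o m₁ :=
    eventually_atTop.2 ⟨m₁ + 1, fun j hj => (hm₁ j (Nat.lt_of_succ_le hj)).le⟩
  obtain ⟨m, -, hout, hym, -⟩ := exists_isOutlet_of_lt_of_eventually_le (Nat.zero_le n) hlt hev
  rcases lt_trichotomy m m₁ with h | rfl | h
  · exact hfirst m h hout
  · exact lt_irrefl _ hym
  · exact absurd (hm₁ m h) (not_lt.2 hym.le)

/-- **Between consecutive outlets the labels stay below the next outlet label**: if `m < m'` are outlets with no outlet strictly between them, then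
`x_n ≤ x_{m'}` for EVERY `n > m` (for `n > m'` even `x_n < x_{m'}`).  Otherwise the last maximiser of the labels after `m` would be an outlet strictly
between `m` and `m'`. [cite: LyonsPeresSchramm2006, Thm. 3.12 (proof)] -/
theorem acceptedLabel_le_of_consecutive {U : Sym2 V → ℝ} {o : V} {m m' : ℕ} (hm' : IsOutlet G U o m') (hmm' : m < m')
    (hcons : ∀ j, m < j → j < m' → ¬ IsOutlet G U o j) {n : ℕ} (hn : m < n) : acceptedLabel G U o n ≤ acceptedLabel G U o m' := by
  by_contra hlt
  push Not at hlt
  have hev : ∀ᶠ j in atTop, acceptedLabel G U o j ≤ acceptedLabel G U o m' :=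
    eventually_atTop.2 ⟨m' + 1, fun j hj => (hm' j (Nat.lt_of_succ_le hj)).le⟩
  obtain ⟨m'', hm''ge, hout, hym, -⟩ := exists_isOutlet_of_lt_of_eventually_le (Nat.succ_le_of_lt hn) hlt hev
  rcases lt_trichotomy m'' m' with h | rfl | h
  · exact hcons m'' (Nat.lt_of_succ_le hm''ge) h hout
  · exact lt_irrefl _ hym
  · exact absurd (hm' m'' h) (not_lt.2 hym.le)

/-! ## §2 Clusters of pond vertices below and at the outlet level -/

/-- **Below the outlet level, clusters of pond vertices stay in the pond closure**: for an outlet `m`, `v ∈ I_m` and `y < x_m`, `C_y(v) ⊆ I_m` (file IX: at a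
step with label `> y` the invaded region is a union of complete `y`-clusters). [cite: ChayesChayesNewman1985, §3 (ii) (clusters are absorbed whole)] -/
theorem openCluster_subset_invasion_of_isOutlet {U : Sym2 V → ℝ} {o : V} {m : ℕ} {v : V} (hv : v ∈ invasion G U o m) {y : ℝ}
    (hy : y < acceptedLabel G U o m) : openCluster (configOfLabels y U G) v ⊆ ↑(invasion G U o m) := by
  rw [coe_invasion_eq_biUnion_openCluster_of_lt_acceptedLabel hy]
  exact Set.subset_biUnion_of_mem (u := fun u => openCluster (configOfLabels y U G) u) hv

/-- Below the outlet level the clusters of pond vertices are finite. [cite: ChayesChayesNewman1985, §3 (ii)] -/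
theorem openCluster_finite_of_lt_acceptedLabel {U : Sym2 V → ℝ} {o : V} {m : ℕ} {v : V} (hv : v ∈ invasion G U o m) {y : ℝ}
    (hy : y < acceptedLabel G U o m) : (openCluster (configOfLabels y U G) v).Finite :=
  (invasion G U o m).finite_toSet.subset (openCluster_subset_invasion_of_isOutlet hv hy)

/-- **After an outlet, the invasion runs inside one cluster at the level of the later labels**: if `m` is an outlet with dart `a` and every label accepted
after `m` is `≤ y`, then every vertex invaded after `m` lies in `C_y(a.2)` (induction along the invasion; the greedy separation lemma keeps the later bonds
off `I_m`). [cite: LyonsPeresSchramm2006, Thm. 3.12 (proof)] -/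
theorem mem_openCluster_snd_of_isOutlet {U : Sym2 V → ℝ} {o : V} {m : ℕ} (hm : IsOutlet G U o m) {a : V × V}
    (ha : newDart G U (invasion G U o m) = some a) {y : ℝ} (hy : ∀ n, m < n → acceptedLabel G U o n ≤ y) :
    ∀ {n : ℕ} {v : V}, v ∈ invasion G U o n → v ∉ invasion G U o m → v ∈ openCluster (configOfLabels y U G) a.2
  | 0, v, hv, hvm => absurd (invasion_mono U o (Nat.zero_le m) hv) hvm
  | n + 1, v, hv, hvm => by
    rw [invasion_succ] at hv
    cases hd : newDart G U (invasion G U o n) with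
    | none =>
      rw [step_of_eq_none G hd] at hv
      exact mem_openCluster_snd_of_isOutlet hm ha hy hv hvm
    | some b =>
      rw [step_of_eq_some G hd, mem_insert] at hv
      rcases hv with rfl | hv
      · rcases lt_trichotomy n m with hlt | rfl | hgt
        · exact absurd (snd_mem_invasion_of_lt hlt hd) hvm
        · obtain rfl : b = a := newDart_some_inj hd ha
          exact mem_openCluster_self _ _
        · have h1 : b.1 ∉ invasion G U o m := fst_not_mem_invasion_of_isOutlet hm hgt hd
          have hb1 : b.1 ∈ openCluster (configOfLabels y U G) a.2 :=
            mem_openCluster_snd_of_isOutlet hm ha hy (fst_mem_of_newDart hd) h1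
          have hle : U s(b.1, b.2) ≤ y := by rw [← acceptedLabel_of_eq_some G hd]; exact hy n hgt
          exact SimpleGraph.Reachable.trans hb1 (openGraph_configOfLabels_adj_of_le (adj_of_newDart hd) hle).reachable
      · exact mem_openCluster_snd_of_isOutlet hm ha hy hv hvm

/-- Every vertex invaded after the outlet `m` has the same `y`-cluster as the far endpoint of the outlet bond, when the later labels are `≤ y`.
[cite: LyonsPeresSchramm2006, Thm. 3.12 (proof)] -/
theorem openCluster_eq_of_invaded_after_outlet {U : Sym2 V → ℝ} {o : V} {m : ℕ} (hm : IsOutlet G U o m) {a : V × V}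
    (ha : newDart G U (invasion G U o m) = some a) {y : ℝ} (hy : ∀ n, m < n → acceptedLabel G U o n ≤ y) {v : V}
    (hv : v ∈ invadedRegion G U o) (hvm : v ∉ invasion G U o m) :
    openCluster (configOfLabels y U G) v = openCluster (configOfLabels y U G) a.2 := by
  obtain ⟨n, hn⟩ := (mem_invadedRegion G).1 hv
  exact openCluster_eq_of_reachable (mem_openCluster_snd_of_isOutlet hm ha hy hn hvm)

/-- **At the level of the later labels, the vertices invaded after an outlet percolate** (infinite connected graph): with `m`, `a`, `y` as above and `v`
invaded after `m`, `C_y(v)` contains every vertex invaded after `m`, an infinite set. [cite: LyonsPeresSchramm2006, Thm. 3.12 (proof)] -/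
theorem infinite_openCluster_of_invaded_after_outlet [Infinite V] (hG : G.Preconnected) {U : Sym2 V → ℝ} {o : V} {m : ℕ}
    (hm : IsOutlet G U o m) {a : V × V} (ha : newDart G U (invasion G U o m) = some a) {y : ℝ}
    (hy : ∀ n, m < n → acceptedLabel G U o n ≤ y) {v : V} (hv : v ∈ invadedRegion G U o) (hvm : v ∉ invasion G U o m) :
    (openCluster (configOfLabels y U G) v).Infinite := by
  rw [openCluster_eq_of_invaded_after_outlet hm ha hy hv hvm]
  have hinf := (invadedRegion_infinite hG U o).sdiff (invasion G U o m).finite_toSet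
  refine hinf.mono fun w hw => ?_
  obtain ⟨n, hn⟩ := (mem_invadedRegion G).1 hw.1
  exact mem_openCluster_snd_of_isOutlet hm ha hy hn fun h => hw.2 (Finset.mem_coe.2 h)

/-! ## §3 The threshold theorems -/

/-- **THE LOCAL THRESHOLD OF A POND VERTEX IS THE LABEL OF THE OUTLET CLOSING ITS POND** (infinite connected graph, every label field): for consecutive
outlet steps `m < m'` and a vertex `v` invaded in `(m, m']` (i.e. `v ∈ I_{m'} ∖ I_m`), the cluster `C_y(v)` is FINITE iff `y < x_{m'}`: below `τ̂ = x_{m'}`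
it is trapped in the pond closure `I_{m'}`, from `τ̂` on it contains everything invaded after `ê_m`. [cite: LyonsPeresSchramm2006, Thm. 3.12 (proof)] -/
theorem openCluster_finite_iff_of_consecutive [Infinite V] (hG : G.Preconnected) {U : Sym2 V → ℝ} {o : V} {m m' : ℕ}
    (hm : IsOutlet G U o m) (hm' : IsOutlet G U o m') (hmm' : m < m') (hcons : ∀ j, m < j → j < m' → ¬ IsOutlet G U o j)
    {v : V} (hv : v ∈ invasion G U o m') (hvm : v ∉ invasion G U o m) (y : ℝ) :
    (openCluster (configOfLabels y U G) v).Finite ↔ y < acceptedLabel G U o m' := by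
  refine ⟨fun hfin => ?_, fun hy => openCluster_finite_of_lt_acceptedLabel hv hy⟩
  by_contra hy
  push Not at hy
  obtain ⟨a, ha⟩ := exists_newDart_eq_some (U := U) (boundaryDarts_invasion_nonempty hG U o m)
  refine (infinite_openCluster_of_invaded_after_outlet hG hm ha (fun n hn => (acceptedLabel_le_of_consecutive hm' hmm' hcons hn).trans hy)
    ((mem_invadedRegion G).2 ⟨m', hv⟩) hvm) hfin

/-- **THE LOCAL THRESHOLD ON THE FIRST POND CLOSURE IS `τ̂_1`**: for the first outlet `m₁` (no earlier outlet) and `v ∈ I_{m₁}`, `C_y(v)` is finite iff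
`y < x_{m₁}`; at level `x_{m₁}` every bond ever absorbed is open, so `C_{x_{m₁}}(v)` contains the whole invaded region.
[cite: LyonsPeresSchramm2006, Thm. 3.12 (proof)] -/
theorem openCluster_finite_iff_of_firstOutlet [Infinite V] (hG : G.Preconnected) {U : Sym2 V → ℝ} {o : V} {m₁ : ℕ}
    (hm₁ : IsOutlet G U o m₁) (hfirst : ∀ j, j < m₁ → ¬ IsOutlet G U o j) {v : V} (hv : v ∈ invasion G U o m₁) (y : ℝ) :
    (openCluster (configOfLabels y U G) v).Finite ↔ y < acceptedLabel G U o m₁ := by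
  refine ⟨fun hfin => ?_, fun hy => openCluster_finite_of_lt_acceptedLabel hv hy⟩
  by_contra hy
  push Not at hy
  have hall : ∀ n, acceptedLabel G U o n ≤ y := fun n => (forall_acceptedLabel_le_of_firstOutlet hm₁ hfirst n).trans hy
  have hinf : (openCluster (configOfLabels y U G) o).Infinite := (forall_acceptedLabel_le_iff_infinite_openCluster hG U o y).1 hall
  obtain ⟨u, hu, hvu⟩ := exists_reachable_of_forall_acceptedLabel_le (n₀ := 0) (fun k _ => hall k) (Nat.zero_le m₁) hv
  rw [invasion_zero, mem_singleton] at hu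
  rw [hu] at hvu
  rw [openCluster_eq_of_reachable hvu] at hfin
  exact hinf hfin

/-- **Every invaded vertex has an outlet label as its local threshold** (infinite connected graph, every label field WITH outlets beyond every time): for
every invaded `v` there is an outlet step `m` with `v ∈ I_m` such that `C_y(v)` is finite iff `y < x_m` (take the first outlet step whose pond closure
contains `v`). [cite: LyonsPeresSchramm2006, Thm. 3.12 (proof)] -/
theorem exists_isOutlet_openCluster_finite_iff [Infinite V] (hG : G.Preconnected) {U : Sym2 V → ℝ} {o : V}
    (hout : ∀ k, ∃ m, k ≤ m ∧ IsOutlet G U o m) {v : V} (hv : v ∈ invadedRegion G U o) :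
    ∃ m, IsOutlet G U o m ∧ v ∈ invasion G U o m ∧ ∀ y : ℝ, (openCluster (configOfLabels y U G) v).Finite ↔ y < acceptedLabel G U o m := by
  classical
  obtain ⟨n, hn⟩ := (mem_invadedRegion G).1 hv
  have hex : ∃ m, IsOutlet G U o m ∧ v ∈ invasion G U o m := by
    obtain ⟨m, hnm, hm⟩ := hout n
    exact ⟨m, hm, invasion_mono U o hnm hn⟩
  -- the first outlet step whose pond closure contains `v`
  set m := Nat.find hex with hmdef
  obtain ⟨hm, hvm⟩ : IsOutlet G U o m ∧ v ∈ invasion G U o m := Nat.find_spec hex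
  refine ⟨m, hm, hvm, ?_⟩
  by_cases hprev : ∃ j, j < m ∧ IsOutlet G U o j
  · -- the last outlet before `m`
    set S : Finset ℕ := (Finset.range m).filter fun j => IsOutlet G U o j with hS
    have hSne : S.Nonempty := by
      obtain ⟨j, hj, hjout⟩ := hprev
      exact ⟨j, by simp [hS, hj, hjout]⟩
    have hmemS := Finset.max'_mem S hSne
    simp only [hS, Finset.mem_filter, Finset.mem_range] at hmemS
    have hvprev : v ∉ invasion G U o (S.max' hSne) := fun h =>
      Nat.find_min hex (m := S.max' hSne) hmemS.1 ⟨hmemS.2, h⟩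
    have hcons : ∀ j, S.max' hSne < j → j < m → ¬ IsOutlet G U o j := by
      intro j hj hjm hjout
      have hjS : j ∈ S := by simp [hS, hjm, hjout]
      exact absurd (Finset.le_max' S j hjS) (not_le.2 hj)
    exact openCluster_finite_iff_of_consecutive hG hmemS.2 hm hmemS.1 hcons hvm hvprev
  · push Not at hprev
    exact openCluster_finite_iff_of_firstOutlet hG hm (fun j hj hjout => hprev j hj hjout) hvm

end General

/-! ## §4 `ℤ^d`: local thresholds along the invasion -/

variable {d : ℕ}

/-- **ON `ℤ^d` (`d ≥ 2`, via p205010), ALMOST SURELY EVERY INVADED VERTEX HAS AN OUTLET LABEL AS ITS LOCAL PERCOLATION THRESHOLD**: for every `v` in the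
invaded region there is an outlet step `m` with `v ∈ I_m`, `x_m > p_c(ℤ^d)`, and `C_y(v)` finite ⟺ `y < x_m` — every invaded vertex percolates exactly
from a SUPERcritical outlet level on (threshold attained), never at `p_c`. [cite: LyonsPeresSchramm2006, Thm. 3.12 (proof)] -/
theorem ae_forall_invaded_threshold_eq_outletLabel (hd : 2 ≤ d) :
    ∀ᵐ U ∂(labelMeasure (Site d)), ∀ v ∈ invadedRegion (zdGraph d) U 0, ∃ m, IsOutlet (zdGraph d) U 0 m ∧ v ∈ invasion (zdGraph d) U 0 m ∧
      criticalProb (zdGraph d) (0 : Site d) < acceptedLabel (zdGraph d) U 0 m ∧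
      ∀ y : ℝ, (openCluster (configOfLabels y U (zdGraph d)) v).Finite ↔ y < acceptedLabel (zdGraph d) U 0 m := by
  haveI : Nonempty (Fin d) := ⟨⟨0, by omega⟩⟩
  haveI : Infinite (Site d) := Pi.infinite_of_right
  filter_upwards [ae_forall_exists_isOutlet hd, ae_outlets hd] with U hU hO
  intro v hv
  obtain ⟨m, hm, hvm, hiff⟩ := exists_isOutlet_openCluster_finite_iff zdGraph_preconnected_holds
    (fun k => (hU k).imp fun m hm => ⟨hm.1, hm.2.1⟩) hv
  exact ⟨m, hm, hvm, hO.2.1 m hm, hiff⟩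

/-- **In particular no invaded vertex of `ℤ^d` percolates at level `p_c(ℤ^d)` or below, while each percolates at some level** (`d ≥ 2`, a.s.): for every
invaded `v`, `C_{p_c}(v)` is finite and `C_y(v)` is infinite for some `y` (namely an outlet label `> p_c`). [cite: LyonsPeresSchramm2006, Thm. 3.12 (proof)] -/
theorem ae_forall_invaded_criticalCluster_finite (hd : 2 ≤ d) :
    ∀ᵐ U ∂(labelMeasure (Site d)), ∀ v ∈ invadedRegion (zdGraph d) U 0,
      (openCluster (configOfLabels (criticalProb (zdGraph d) (0 : Site d)) U (zdGraph d)) v).Finite ∧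
      ∃ y : ℝ, criticalProb (zdGraph d) (0 : Site d) < y ∧ (openCluster (configOfLabels y U (zdGraph d)) v).Infinite := by
  filter_upwards [ae_forall_invaded_threshold_eq_outletLabel hd] with U hU
  intro v hv
  obtain ⟨m, -, -, hpc, hiff⟩ := hU v hv
  exact ⟨(hiff _).2 hpc, acceptedLabel (zdGraph d) U 0 m, hpc, fun h => lt_irrefl _ ((hiff _).1 h)⟩

/-- **THE INVASION THREADS VERTICES OF EVER LOWER (SUPERCRITICAL) LOCAL THRESHOLD** (`d ≥ 2`, a.s.): for every `y > p_c(ℤ^d)` the invasion reaches a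
vertex `v` whose cluster `C_y(v)` is infinite while `C_{y'}(v)` is finite for every `y' < τ̂` for some outlet label `τ̂ ∈ (p_c, y]` — local thresholds
along the invasion come arbitrarily close to `p_c` from above (they are the outlet labels `τ̂_k ↓ p_c`). [cite: LyonsPeresSchramm2006, Thm. 3.12 (proof)] -/
theorem ae_exists_invaded_threshold_lt (hd : 2 ≤ d) :
    ∀ᵐ U ∂(labelMeasure (Site d)), ∀ y : ℝ, criticalProb (zdGraph d) (0 : Site d) < y →
      ∃ v ∈ invadedRegion (zdGraph d) U 0, ∃ m, IsOutlet (zdGraph d) U 0 m ∧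
        criticalProb (zdGraph d) (0 : Site d) < acceptedLabel (zdGraph d) U 0 m ∧ acceptedLabel (zdGraph d) U 0 m ≤ y ∧
        (openCluster (configOfLabels y U (zdGraph d)) v).Infinite ∧
        ∀ y' : ℝ, y' < acceptedLabel (zdGraph d) U 0 m → (openCluster (configOfLabels y' U (zdGraph d)) v).Finite := by
  haveI : Nonempty (Fin d) := ⟨⟨0, by omega⟩⟩
  haveI : Infinite (Site d) := Pi.infinite_of_right
  filter_upwards [ae_forall_exists_isOutlet hd, ae_outlets hd] with U hU hO
  intro y hy
  -- an outlet `m` with label `≤ y`, then a later outlet `m'`; the vertex `a'.2` invaded at `m'` works, with its own threshold outlet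
  obtain ⟨K, hK⟩ := eventually_atTop.1 (hO.2.2.2 y hy)
  obtain ⟨m, hKm, hm, -⟩ := hU K
  have hmy : acceptedLabel (zdGraph d) U 0 m ≤ y := ((hK m hKm) hm).2
  obtain ⟨a, ha⟩ := exists_newDart_eq_some (U := U) (boundaryDarts_invasion_nonempty zdGraph_preconnected_holds U 0 m)
  have hv : a.2 ∈ invadedRegion (zdGraph d) U 0 :=
    (mem_invadedRegion _).2 ⟨m + 1, snd_mem_invasion_of_lt (Nat.lt_succ_self m) ha⟩
  obtain ⟨m', hm', hvm', hiff⟩ := exists_isOutlet_openCluster_finite_iff zdGraph_preconnected_holds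
    (fun k => (hU k).imp fun m hm => ⟨hm.1, hm.2.1⟩) hv
  -- `a.2 ∉ I_m`, so `m < m'` and `x_{m'} < x_m ≤ y`
  have hmm' : m < m' := by
    by_contra h
    exact snd_not_mem_of_newDart ha (invasion_mono U 0 (not_lt.1 h) hvm')
  have hlt : acceptedLabel (zdGraph d) U 0 m' < acceptedLabel (zdGraph d) U 0 m := hm m' hmm'
  refine ⟨a.2, hv, m', hm', hO.2.1 m' hm', hlt.le.trans hmy, fun hfin => ?_, fun y' hy' => (hiff y').2 hy'⟩
  exact absurd ((hiff y).1 hfin) (not_lt.2 (hlt.le.trans hmy))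

end Summit.CriticalPhenomena.PercolationContinuityZ3.Theorems.Rsw3
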